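import Literature.Analysis.FluidPDE.LocalTypeI
import Literature.Analysis.FluidPDE.SereginSverakLocalEnergy
import Literature.Analysis.FluidPDE.LocalEnergyLimitVelocity
import Literature.Analysis.FluidPDE.WeakGradientWeakLimitL2
import Literature.Analysis.FluidPDE.SuitableWeakStability
import Literature.Analysis.FluidPDE.SuitableWeakRescaling
import Literature.Analysis.FunctionSpaces.WeakCompactnessLpFinite
import HarnessLib

/-!
# Compactness of suitable weak solutions (Albritton–Barker 2019, Lemma 2.2): proof

Analysis/FluidPDE proofs file (no new definitions, no named facts) **discharging the named fact**
`Literature.Analysis.FluidPDE.SuitableCompactness` of `LocalTypeI.lean`: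

> **Lemma 2.2 (Compactness).** Let `(v^{(k)}, q^{(k)})_{k ∈ ℕ}` be a sequence of suitable weak
> solutions on `Q` satisfying `sup_k ‖v^{(k)}‖_{L³(Q)} + ‖q^{(k)}‖_{L^{3/2}(Q)} < ∞`. Then there
> exists a suitable weak solution `(u, p)` on `Q(R)` for all `0 < R < 1` such that
> `v^{(k)} → u` in `L³_loc(B × ]-1, 0])`, `q^{(k)} ⇀ p` in `L^{3/2}_loc(B × ]-1, 0])`, along a
> subsequence.

(D. Albritton, T. Barker, arXiv:1811.00502, p. 5: "The following lemma is proven in [Lin 1998].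
The proof relies on the local energy inequality, the embedding
`L^∞_t L²_x ∩ L²_t H¹_x(Q) ↪ L^{10/3}(Q)`, and the Aubin–Lions lemma.")

## The proof (`SuitableCompactness_holds`)

All the analysis is in accepted files of the tree; this file is the bookkeeping.

1. *Uniform local energy bounds* (`SuitableCompactness.exists_uniform_energy_bounds`). From the
   uniform `L³(Q)` / `L^{3/2}(Q)` bounds, the local energy inequality gives, for every `R < 1`,
   uniform bounds `esssup_{-R² < t < 0} ∫_{B_R} |v^{(k)}(t)|² ≤ C_R` and
   `∫_{Q(R)} |∇v^{(k)}|² ≤ C_R`: the tree's estimate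
   `E(z₀, r/2) + A(z₀, r/2) ≤ c (C^{2/3} + C + D)(z₀, r)` for suitable weak solutions
   (`SereginSverak2009.dissipationE_add_energyA_le_of_suitable`; Seregin–Šverák 2009, proof of
   Lemma 3.5; Lin 1998, §2; CKN 1982, §2) on finitely many small cylinders `Q(z₀, r)`,
   `r = (1 - R)/2`, covering `Q(R)` up to its top `t = 0`, with `Q(z₀, r) ⊆ Q`.
2. *Pressures* (`FunctionSpaces.exists_subseq_tendsto_integral_mul_of_lintegral_rpow_le'`): a
   subsequence `σ₀` and `p ∈ L^{3/2}(Q)` with `q^{(σ₀ k)} ⇀ p` weakly in `L^{3/2}(Q)` (tested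
   against `L³(Q)`), hence weakly in `L^{3/2}(Q(R))` for every `R ≤ 1`.
3. *Velocities* (`SuitableCompactness.velocity_extraction`): on the balls `Q(R_n)`,
   `R_n = 1 - 1/(n+2) ↑ 1`, the Aubin–Lions theorem of the tree
   (`NSCylinder.exists_subseq_strong_limit_velocity_ball`), Cantor's diagonal procedure
   (`FunctionSpaces.exists_strictMono_forall_of_extraction`) and the gluing of the (a.e. unique)
   `L²` limits (`FunctionSpaces.exists_glue_of_ae_eq`) give one subsequence `φ` and one field `u`
   on `Q` with `v^{(σ₀ φ k)} → u` in `L²(Q(R_n))` for every `n`; by the uniform `L^{10/3}` bound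
   (`exists_lintegral_tenThirds_backward_le`) the convergence is in `L³(Q(R_n))`
   (`FunctionSpaces.tendsto_eLpNorm_three_of_sq_of_tenThirds`).
4. *Suitability of the limit* (`SuitableCompactness.limit_isSuitableWeakSolutionInBall`): on each
   `Q(R_n)` a further subsequence of the gradients converges weakly in `L²` to a weak spatial
   gradient of `u` (`exists_hasWeakSpatialGradientOn_of_weakGradient_approx_L2`), and the
   stability theorem `isSuitableWeakSolutionOn_of_tendsto` (CKN 1982, §2; Lin 1998, Thm. 2.2)
   shows that `(u, p)` is a suitable weak solution on `Q(R_n)` in the class of A–B's Def. 2.1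
   (`IsSuitableWeakSolutionInBall`).
5. Every `R ∈ (0, 1)` lies below some `R_n`; all conclusions restrict from `Q(R_n)` to `Q(R)`.

## References

* D. Albritton, T. Barker, *On local Type I singularities of the Navier–Stokes equations and
  Liouville theorems*, J. Math. Fluid Mech. 21 (2019) = arXiv:1811.00502, Def. 2.1, Lemma 2.2
  (p. 5). [AlbrittonBarker2019]
* F. Lin, *A new proof of the Caffarelli–Kohn–Nirenberg theorem*, CPAM 51 (1998), Thm. 2.2.
  [Lin1998]
* L. Caffarelli, R. Kohn, L. Nirenberg, CPAM 35 (1982), §2. [CaffarelliKohnNirenberg1982]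
* G. Seregin, V. Šverák, Comm. PDE 34 (2009) = arXiv:0804.1803, proof of Lemma 3.5 (as12).
  [SereginSverak2009]
-/

noncomputable section

open MeasureTheory Set Function Filter Topology TopologicalSpace Metric
open scoped NNReal ENNReal InnerProductSpace RealInnerProductSpace

namespace Literature.Analysis.FluidPDE

namespace SuitableCompactness

/-! ### Geometry of the parabolic balls `Q(R) = Q(0, R)` -/

/-- `Q(0, R) = ]-R², 0[ × B(0, R)`. [folklore] -/
theorem parabolicCylinder_zero (R : ℝ) :
    parabolicCylinder R (0 : ℝ × (EuclideanSpace ℝ (Fin 3))) = Ioo (-R ^ 2) 0 ×ˢ ball (0 : (EuclideanSpace ℝ (Fin 3))) R := by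
  simp only [parabolicCylinder, Prod.fst_zero, Prod.snd_zero, zero_sub]

/-- Membership in `Q(0, R)`. [folklore] -/
theorem mem_parabolicCylinder_zero {R : ℝ} {z : ℝ × (EuclideanSpace ℝ (Fin 3))} :
    z ∈ parabolicCylinder R (0 : ℝ × (EuclideanSpace ℝ (Fin 3))) ↔ (-R ^ 2 < z.1 ∧ z.1 < 0) ∧ ‖z.2‖ < R := by
  rw [parabolicCylinder_zero, mem_prod, mem_Ioo, mem_ball_zero_iff]

/-- The time cylinder `]-R², 0[ × B(0, R)` of `NSSuitableESS` is the parabolic ball `Q(0, R)`.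
[folklore] -/
theorem timeCylinder_ball_eq (R : ℝ) :
    timeCylinder (⟨ball (0 : (EuclideanSpace ℝ (Fin 3))) R, isOpen_ball⟩ : Opens (EuclideanSpace ℝ (Fin 3))) (-R ^ 2) 0 =
      parabolicCylinderOpens R (0 : ℝ × (EuclideanSpace ℝ (Fin 3))) := by
  refine TopologicalSpace.Opens.ext ?_
  rw [coe_timeCylinder, coe_parabolicCylinderOpens, parabolicCylinder_zero]
  rfl

/-- The parabolic balls about the origin increase with the radius. [folklore] -/
theorem parabolicCylinder_zero_mono {R R' : ℝ} (hR : 0 ≤ R) (h : R ≤ R') :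
    parabolicCylinder R (0 : ℝ × (EuclideanSpace ℝ (Fin 3))) ⊆ parabolicCylinder R' (0 : ℝ × (EuclideanSpace ℝ (Fin 3))) := by
  intro z hz
  rw [mem_parabolicCylinder_zero] at hz ⊢
  have h2 : R ^ 2 ≤ R' ^ 2 := pow_le_pow_left₀ hR h 2
  exact ⟨⟨by linarith [hz.1.1], hz.1.2⟩, hz.2.trans_le h⟩

/-- The same monotonicity for the `Opens`. [folklore] -/
theorem parabolicCylinderOpens_zero_mono {R R' : ℝ} (hR : 0 ≤ R) (h : R ≤ R') :
    parabolicCylinderOpens R (0 : ℝ × (EuclideanSpace ℝ (Fin 3))) ≤ parabolicCylinderOpens R' (0 : ℝ × (EuclideanSpace ℝ (Fin 3))) :=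
  fun _ hz => parabolicCylinder_zero_mono hR h hz

/-- `Q(0, R)` has finite volume. [folklore] -/
theorem volume_parabolicCylinder_zero_ne_top (R : ℝ) :
    volume (parabolicCylinder R (0 : ℝ × (EuclideanSpace ℝ (Fin 3)))) ≠ ∞ := by
  rw [parabolicCylinder_zero, Measure.volume_eq_prod, Measure.prod_prod]
  exact ENNReal.mul_ne_top measure_Ioo_lt_top.ne measure_ball_lt_top.ne

/-- Lebesgue measure restricted to `Q(0, R)` is finite. [folklore] -/
theorem isFiniteMeasure_restrict_parabolicCylinder_zero (R : ℝ) :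
    IsFiniteMeasure ((volume : Measure (ℝ × (EuclideanSpace ℝ (Fin 3)))).restrict (parabolicCylinder R (0 : ℝ × (EuclideanSpace ℝ (Fin 3))))) :=
  ⟨by rw [Measure.restrict_apply_univ]; exact (volume_parabolicCylinder_zero_ne_top R).lt_top⟩

/-- Tonelli for a.e. statements on a box `]a, b[ × B`. [folklore] -/
theorem ae_ae_of_ae_prod_restrict {a b : ℝ} {B : Set (EuclideanSpace ℝ (Fin 3))} {P : ℝ × (EuclideanSpace ℝ (Fin 3)) → Prop}
    (h : ∀ᵐ z ∂(volume.restrict (Ioo a b ×ˢ B)), P z) :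
    ∀ᵐ t ∂(volume.restrict (Ioo a b)), ∀ᵐ x ∂(volume.restrict B), P (t, x) := by
  have hprod : (volume.restrict (Ioo a b ×ˢ B)) =
      ((volume : Measure ℝ).restrict (Ioo a b)).prod ((volume : Measure (EuclideanSpace ℝ (Fin 3))).restrict B) := by
    rw [Measure.volume_eq_prod, Measure.prod_restrict]
  rw [hprod] at h
  exact Measure.ae_ae_of_ae_prod h

/-! ### Finite covers of the closed time interval and of the closed ball -/

/-- A finite `δ`-net of `[-R², 0]`. [folklore] -/
theorem exists_time_net (R : ℝ) {δ : ℝ} (hδ : 0 < δ) :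
    ∃ T : Finset ℝ, (∀ s ∈ T, s ∈ Icc (-R ^ 2) 0) ∧
      ∀ t ∈ Icc (-R ^ 2) 0, ∃ s ∈ T, dist t s < δ := by
  obtain ⟨T, hTs, hTf, hcov⟩ := finite_cover_balls_of_compact (isCompact_Icc (a := -R ^ 2) (b := 0)) hδ
  refine ⟨hTf.toFinset, fun s hs => hTs (hTf.mem_toFinset.1 hs), fun t ht => ?_⟩
  obtain ⟨s, hs, hts⟩ := mem_iUnion₂.1 (hcov ht)
  exact ⟨s, hTf.mem_toFinset.2 hs, mem_ball.1 hts⟩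

/-- A finite `ε`-net of the closed ball `B̄(0, R)`. [folklore] -/
theorem exists_space_net (R : ℝ) {ε : ℝ} (hε : 0 < ε) :
    ∃ X : Finset (EuclideanSpace ℝ (Fin 3)), (∀ c ∈ X, c ∈ closedBall (0 : (EuclideanSpace ℝ (Fin 3))) R) ∧
      ∀ x ∈ closedBall (0 : (EuclideanSpace ℝ (Fin 3))) R, ∃ c ∈ X, dist x c < ε := by
  obtain ⟨X, hXs, hXf, hcov⟩ := finite_cover_balls_of_compact (isCompact_closedBall (0 : (EuclideanSpace ℝ (Fin 3))) R) hε
  refine ⟨hXf.toFinset, fun c hc => hXs (hXf.mem_toFinset.1 hc), fun x hx => ?_⟩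
  obtain ⟨c, hc, hxc⟩ := mem_iUnion₂.1 (hcov hx)
  exact ⟨c, hXf.mem_toFinset.2 hc, mem_ball.1 hxc⟩

/-! ### The small Seregin–Šverák cylinders of the covering -/

/-- Membership in a Seregin–Šverák cylinder with an explicit centre. [folklore] -/
theorem mem_parCyl_mk {τ r : ℝ} {c : (EuclideanSpace ℝ (Fin 3))} {z : ℝ × (EuclideanSpace ℝ (Fin 3))} :
    z ∈ SereginSverak2009.parCyl (τ, c) r ↔
      (τ - r ^ 2 < z.1 ∧ z.1 < τ) ∧ z.2 ∈ SereginSverak2009.spaceCyl c r :=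
  Iff.rfl

/-- A point of `𝒞(c, r)` is at distance `< 2r` from `c` (indeed `< √2 r`). [folklore] -/
theorem norm_sub_lt_of_mem_spaceCyl {c x : (EuclideanSpace ℝ (Fin 3))} {r : ℝ} (hr : 0 < r)
    (h : x ∈ SereginSverak2009.spaceCyl c r) : ‖x - c‖ < 2 * r := by
  have h2 := SereginSverak2009.norm_sub_sq_lt_of_mem_spaceCyl h
  have h4 : ‖x - c‖ ^ 2 < (2 * r) ^ 2 := by nlinarith
  exact lt_of_pow_lt_pow_left₀ 2 (by positivity) h4

/-- **The covering cylinders lie in `Q`**: for `0 < R < 1`, `r = (1 - R)/2`, a time centre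
`τ = min (s + δ) 0` with `s ∈ [-R², 0]`, `δ ≥ 0`, and a space centre `c ∈ B̄(0, R)`, the
Seregin–Šverák cylinder `Q((τ, c), r) = ]τ - r², τ[ × 𝒞(c, r)` lies in `Q(0, 1)`. [folklore] -/
theorem parCyl_subset_parabolicCylinder_one {R : ℝ} (hR0 : 0 < R) (hR1 : R < 1) {s δ : ℝ}
    (hs : s ∈ Icc (-R ^ 2) 0) (hδ : 0 ≤ δ) {c : (EuclideanSpace ℝ (Fin 3))} (hc : c ∈ closedBall (0 : (EuclideanSpace ℝ (Fin 3))) R) :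
    SereginSverak2009.parCyl (min (s + δ) 0, c) ((1 - R) / 2) ⊆
      parabolicCylinder 1 (0 : ℝ × (EuclideanSpace ℝ (Fin 3))) := by
  intro z hz
  rw [mem_parCyl_mk] at hz
  obtain ⟨⟨h1, h2⟩, hx⟩ := hz
  rw [mem_parabolicCylinder_zero]
  have hmin0 : min (s + δ) 0 ≤ 0 := min_le_right _ _
  have hminl : -R ^ 2 ≤ min (s + δ) 0 := le_min (by linarith [hs.1]) (by nlinarith [sq_nonneg R])
  have hq : 5 * R ^ 2 - 2 * R - 3 ≤ 0 := by nlinarith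
  refine ⟨⟨by nlinarith, by linarith⟩, ?_⟩
  have hr : 0 < (1 - R) / 2 := by linarith
  have hxc := norm_sub_lt_of_mem_spaceCyl hr hx
  have hc' : ‖c‖ ≤ R := mem_closedBall_zero_iff.1 hc
  calc ‖z.2‖ = ‖(z.2 - c) + c‖ := by rw [sub_add_cancel]
    _ ≤ ‖z.2 - c‖ + ‖c‖ := norm_add_le _ _
    _ < 2 * ((1 - R) / 2) + R := add_lt_add_of_lt_of_le hxc hc'
    _ = 1 := by ring

/-- **The covering cylinders cover**: with `δ = r²/16`, a time `t < 0` within `δ` of `s` and a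
point `x` within `r/2` of `c` give `(t, x) ∈ Q((min (s + δ) 0, c), r/2)`. [folklore] -/
theorem mem_parCyl_half_of_near {r s t : ℝ} (ht0 : t < 0)
    (hts : dist t s < r ^ 2 / 16) {c x : (EuclideanSpace ℝ (Fin 3))} (hxc : dist x c < r / 2) :
    (t, x) ∈ SereginSverak2009.parCyl (min (s + r ^ 2 / 16) 0, c) (r / 2) := by
  rw [mem_parCyl_mk]
  rw [Real.dist_eq] at hts
  obtain ⟨hts1, hts2⟩ := abs_lt.1 hts
  refine ⟨⟨?_, lt_min (by linarith) ht0⟩, ?_⟩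
  · have : min (s + r ^ 2 / 16) 0 ≤ s + r ^ 2 / 16 := min_le_left _ _
    nlinarith
  · refine SereginSverak2009.mem_spaceCyl_of_norm_lt ?_
    rwa [← dist_eq_norm]

/-! ### Step 1: uniform local energy bounds from the `L³ × L^{3/2}` bound -/

/-- From `a⁻¹ x ≤ B` to `x ≤ a B` in `ℝ≥0∞` (`a ≠ 0, ∞`). [folklore] -/
theorem le_mul_of_inv_mul_le {a x B : ℝ≥0∞} (ha0 : a ≠ 0) (hat : a ≠ ∞) (h : a⁻¹ * x ≤ B) :
    x ≤ a * B :=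
  calc x = a * (a⁻¹ * x) := by rw [← mul_assoc, ENNReal.mul_inv_cancel ha0 hat, one_mul]
    _ ≤ a * B := mul_le_mul_right h a

/-- **Uniform local energy bounds** (Albritton–Barker 2019, proof of Lemma 2.2, "the proof relies
on the local energy inequality"; Lin 1998, §2; CKN 1982, §2). For `0 < R < 1` and finite bounds
`M_u, M_p` there is `C = C(R, M_u, M_p)` such that every suitable weak solution `(u, p)` on
`Q = Q(0, 1)` with `∫_Q |u|³ ≤ M_u`, `∫_Q |p|^{3/2} ≤ M_p` and every weak spatial gradient `G`
of `u` on `Q` satisfy `∫_{B(0,R)} |u(t)|² ≤ C` for a.e. `t ∈ ]-R², 0[` and `∫_{Q(R)} |G|² ≤ C`.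
Proof: the estimate `E(z₀, r/2) + A(z₀, r/2) ≤ c (C^{2/3} + C + D)(z₀, r)`
(`SereginSverak2009.dissipationE_add_energyA_le_of_suitable`) on the finitely many cylinders
`Q((τ, c), r)`, `r = (1 - R)/2`, of a net of centres, which lie in `Q` and whose halves cover
`Q(R)`. [cite: AlbrittonBarker2019, Lemma 2.2 (proof sketch, arXiv p. 5)] -/
theorem exists_uniform_energy_bounds {R : ℝ} (hR0 : 0 < R) (hR1 : R < 1) {Mu Mp : ℝ≥0∞}
    (hMu : Mu ≠ ∞) (hMp : Mp ≠ ∞) :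
    ∃ C : ℝ≥0, ∀ (u : ℝ → (EuclideanSpace ℝ (Fin 3)) → (EuclideanSpace ℝ (Fin 3))) (p : ℝ → (EuclideanSpace ℝ (Fin 3)) → ℝ) (G : ℝ → (EuclideanSpace ℝ (Fin 3)) → (EuclideanSpace ℝ (Fin 3)) →L[ℝ] (EuclideanSpace ℝ (Fin 3))),
      IsSuitableWeakSolutionOn (parabolicCylinderOpens 1 (0 : ℝ × (EuclideanSpace ℝ (Fin 3)))) 1 0 u p →
      HasWeakSpatialGradientOn (parabolicCylinderOpens 1 (0 : ℝ × (EuclideanSpace ℝ (Fin 3)))) u G →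
      ∫⁻ z in parabolicCylinder 1 (0 : ℝ × (EuclideanSpace ℝ (Fin 3))), ‖u z.1 z.2‖ₑ ^ (3 : ℕ) ≤ Mu →
      ∫⁻ z in parabolicCylinder 1 (0 : ℝ × (EuclideanSpace ℝ (Fin 3))), ‖p z.1 z.2‖ₑ ^ (3 / 2 : ℝ) ≤ Mp →
      (∀ᵐ t ∂(volume.restrict (Ioo (-R ^ 2) 0)),
          ∫⁻ x in ball (0 : (EuclideanSpace ℝ (Fin 3))) R, ‖u t x‖ₑ ^ 2 ≤ C) ∧
        ∫⁻ z in parabolicCylinder R (0 : ℝ × (EuclideanSpace ℝ (Fin 3))),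
          ENNReal.ofReal (frobeniusNormSq (G z.1 z.2)) ≤ C := by
  obtain ⟨c, hc⟩ := SereginSverak2009.dissipationE_add_energyA_le_of_suitable
  -- the radius of the covering cylinders and the nets of centres
  set r : ℝ := (1 - R) / 2 with hr
  have hr0 : 0 < r := by rw [hr]; linarith
  have hδ0 : 0 < r ^ 2 / 16 := by positivity
  obtain ⟨Tc, hTc, hTcov⟩ := exists_time_net R hδ0
  obtain ⟨Xc, hXc, hXcov⟩ := exists_space_net R (half_pos hr0)
  set τ : ℝ → ℝ := fun s => min (s + r ^ 2 / 16) 0 with hτ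
  set I : Finset (ℝ × (EuclideanSpace ℝ (Fin 3))) := Tc ×ˢ Xc with hI
  -- the bound on one cylinder
  set ρ : ℝ≥0∞ := ENNReal.ofReal r with hρ
  have hρ0 : ρ ≠ 0 := (ENNReal.ofReal_pos.2 hr0).ne'
  have hρ2 : (ρ ^ 2)⁻¹ ≠ ∞ := ENNReal.inv_ne_top.2 (pow_ne_zero 2 hρ0)
  set B : ℝ≥0∞ := (c : ℝ≥0∞) *
    (((ρ ^ 2)⁻¹ * Mu) ^ (2 / 3 : ℝ) + (ρ ^ 2)⁻¹ * Mu + (ρ ^ 2)⁻¹ * Mp) with hB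
  have hBtop : B ≠ ∞ := by
    refine ENNReal.mul_ne_top ENNReal.coe_ne_top (ENNReal.add_ne_top.2 ⟨ENNReal.add_ne_top.2
      ⟨ENNReal.rpow_ne_top_of_nonneg (by norm_num) (ENNReal.mul_ne_top hρ2 hMu),
        ENNReal.mul_ne_top hρ2 hMu⟩, ENNReal.mul_ne_top hρ2 hMp⟩)
  set ρ' : ℝ≥0∞ := ENNReal.ofReal (r / 2) with hρ'
  have hρ'0 : ρ' ≠ 0 := (ENNReal.ofReal_pos.2 (half_pos hr0)).ne'
  have hρ't : ρ' ≠ ∞ := ENNReal.ofReal_ne_top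
  set Cval : ℝ≥0∞ := (I.card : ℝ≥0∞) * (ρ' * B) with hCval
  have hCtop : Cval ≠ ∞ :=
    ENNReal.mul_ne_top (ENNReal.natCast_ne_top _) (ENNReal.mul_ne_top hρ't hBtop)
  refine ⟨Cval.toNNReal, fun u p G hsw hG hu hp => ?_⟩
  rw [ENNReal.coe_toNNReal hCtop]
  -- the cylinders of the covering lie in `Q`
  have hsub : ∀ i ∈ I, SereginSverak2009.parCyl (τ i.1, i.2) r ⊆
      ((parabolicCylinderOpens 1 (0 : ℝ × (EuclideanSpace ℝ (Fin 3))) : Opens (ℝ × (EuclideanSpace ℝ (Fin 3)))) : Set (ℝ × (EuclideanSpace ℝ (Fin 3)))) := by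
    intro i hi
    rw [hI, Finset.mem_product] at hi
    rw [coe_parabolicCylinderOpens]
    exact parCyl_subset_parabolicCylinder_one hR0 hR1 (hTc _ hi.1) hδ0.le (hXc _ hi.2)
  -- `|u|³ ∈ L¹(Q)`
  have hum : AEStronglyMeasurable (fun z : ℝ × (EuclideanSpace ℝ (Fin 3)) => u z.1 z.2)
      (volume.restrict (parabolicCylinder 1 (0 : ℝ × (EuclideanSpace ℝ (Fin 3))))) :=
    hsw.distributional.1.aestronglyMeasurable
  have hloc : LocallyIntegrableOn (fun z : ℝ × (EuclideanSpace ℝ (Fin 3)) => ‖u z.1 z.2‖ ^ 3)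
      ((parabolicCylinderOpens 1 (0 : ℝ × (EuclideanSpace ℝ (Fin 3))) : Opens (ℝ × (EuclideanSpace ℝ (Fin 3)))) : Set (ℝ × (EuclideanSpace ℝ (Fin 3)))) volume := by
    rw [coe_parabolicCylinderOpens]
    refine IntegrableOn.locallyIntegrableOn ⟨hum.norm.pow 3, ?_⟩
    rw [HasFiniteIntegral]
    calc ∫⁻ z in parabolicCylinder 1 (0 : ℝ × (EuclideanSpace ℝ (Fin 3))), ‖‖u z.1 z.2‖ ^ 3‖ₑ
        = ∫⁻ z in parabolicCylinder 1 (0 : ℝ × (EuclideanSpace ℝ (Fin 3))), ‖u z.1 z.2‖ₑ ^ (3 : ℕ) := by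
          refine lintegral_congr fun z => ?_
          rw [Real.enorm_eq_ofReal (by positivity), ENNReal.ofReal_pow (norm_nonneg _),
            ofReal_norm]
      _ ≤ Mu := hu
      _ < ∞ := hMu.lt_top
  -- the estimate on each cylinder of the covering
  have hkey : ∀ i ∈ I, SereginSverak2009.dissipationE (τ i.1, i.2) (r / 2) G +
      SereginSverak2009.energyA (τ i.1, i.2) (r / 2) u ≤ B := by
    intro i hi
    refine (hc _ u p G hsw hloc hG (τ i.1, i.2) r hr0 (hsub i hi)).trans ?_
    have hsub' : SereginSverak2009.parCyl (τ i.1, i.2) r ⊆ parabolicCylinder 1 (0 : ℝ × (EuclideanSpace ℝ (Fin 3))) := by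
      have h := hsub i hi
      rwa [coe_parabolicCylinderOpens] at h
    have hC : SereginSverak2009.cubicC (τ i.1, i.2) r u ≤ (ρ ^ 2)⁻¹ * Mu := by
      rw [SereginSverak2009.cubicC]
      exact mul_le_mul_right ((lintegral_mono_set hsub').trans hu) _
    have hD : SereginSverak2009.pressureD (τ i.1, i.2) r p ≤ (ρ ^ 2)⁻¹ * Mp := by
      rw [SereginSverak2009.pressureD]
      exact mul_le_mul_right ((lintegral_mono_set hsub').trans hp) _
    rw [hB]
    gcongr
  -- the bounds on the halves of the covering cylinders
  have hEi : ∀ i ∈ I, ∫⁻ z in SereginSverak2009.parCyl (τ i.1, i.2) (r / 2),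
      ENNReal.ofReal (frobeniusNormSq (G z.1 z.2)) ≤ ρ' * B := by
    intro i hi
    refine le_mul_of_inv_mul_le hρ'0 hρ't ?_
    exact le_trans le_self_add (hkey i hi)
  have hAi : ∀ i ∈ I, ∀ᵐ t : ℝ, t ∈ Ioo (τ i.1 - (r / 2) ^ 2) (τ i.1) →
      ∫⁻ x in SereginSverak2009.spaceCyl i.2 (r / 2), ‖u t x‖ₑ ^ 2 ≤ ρ' * B := by
    intro i hi
    have hA : SereginSverak2009.energyA (τ i.1, i.2) (r / 2) u ≤ B :=
      le_trans le_add_self (hkey i hi)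
    rw [SereginSverak2009.energyA] at hA
    have hae := ENNReal.ae_le_essSup (μ := volume.restrict (Ioo (τ i.1 - (r / 2) ^ 2) (τ i.1)))
      (fun t : ℝ => (ENNReal.ofReal (r / 2))⁻¹ *
        ∫⁻ x in SereginSverak2009.spaceCyl i.2 (r / 2), ‖u t x‖ₑ ^ 2)
    rw [← ae_restrict_iff' measurableSet_Ioo]
    filter_upwards [hae] with t ht
    exact le_mul_of_inv_mul_le hρ'0 hρ't (ht.trans hA)
  constructor
  · -- the slices
    have hall : ∀ᵐ t : ℝ, ∀ i ∈ I, t ∈ Ioo (τ i.1 - (r / 2) ^ 2) (τ i.1) →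
        ∫⁻ x in SereginSverak2009.spaceCyl i.2 (r / 2), ‖u t x‖ₑ ^ 2 ≤ ρ' * B :=
      (eventually_all_finset I).2 hAi
    rw [ae_restrict_iff' measurableSet_Ioo]
    · filter_upwards [hall] with t ht htI
      classical
      set It : Finset (ℝ × (EuclideanSpace ℝ (Fin 3))) := I.filter (fun i => t ∈ Ioo (τ i.1 - (r / 2) ^ 2) (τ i.1))
        with hIt
      -- the slice of the cover
      have hcov : ball (0 : (EuclideanSpace ℝ (Fin 3))) R ⊆ ⋃ i ∈ It, SereginSverak2009.spaceCyl i.2 (r / 2) := by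
        intro x hx
        obtain ⟨s, hs, hts⟩ := hTcov t (Ioo_subset_Icc_self htI)
        obtain ⟨c', hc', hxc⟩ := hXcov x (ball_subset_closedBall hx)
        have hmem := mem_parCyl_half_of_near htI.2 hts hxc
        rw [mem_parCyl_mk] at hmem
        refine mem_iUnion₂.2 ⟨(s, c'), ?_, hmem.2⟩
        rw [hIt, Finset.mem_filter, hI, Finset.mem_product]
        exact ⟨⟨hs, hc'⟩, hmem.1⟩
      calc ∫⁻ x in ball (0 : (EuclideanSpace ℝ (Fin 3))) R, ‖u t x‖ₑ ^ 2
          ≤ ∫⁻ x in ⋃ i ∈ It, SereginSverak2009.spaceCyl i.2 (r / 2), ‖u t x‖ₑ ^ 2 :=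
            lintegral_mono_set hcov
        _ ≤ It.card * (ρ' * B) := by
            refine lintegral_biUnion_finset_le_card_mul It _ _ fun i hi => ?_
            rw [hIt, Finset.mem_filter] at hi
            exact ht i hi.1 hi.2
        _ ≤ I.card * (ρ' * B) := by
            gcongr
            rw [hIt]
            exact Finset.filter_subset _ _
  · -- the gradient
    have hcov : parabolicCylinder R (0 : ℝ × (EuclideanSpace ℝ (Fin 3))) ⊆
        ⋃ i ∈ I, SereginSverak2009.parCyl (τ i.1, i.2) (r / 2) := by
      intro z hz
      rw [mem_parabolicCylinder_zero] at hz
      obtain ⟨s, hs, hts⟩ := hTcov z.1 (Ioo_subset_Icc_self hz.1)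
      obtain ⟨c', hc', hxc⟩ := hXcov z.2 (mem_closedBall_zero_iff.2 hz.2.le)
      have hmem := mem_parCyl_half_of_near hz.1.2 hts hxc
      refine mem_iUnion₂.2 ⟨(s, c'), ?_, hmem⟩
      rw [hI, Finset.mem_product]
      exact ⟨hs, hc'⟩
    calc ∫⁻ z in parabolicCylinder R (0 : ℝ × (EuclideanSpace ℝ (Fin 3))), ENNReal.ofReal (frobeniusNormSq (G z.1 z.2))
        ≤ ∫⁻ z in ⋃ i ∈ I, SereginSverak2009.parCyl (τ i.1, i.2) (r / 2),
            ENNReal.ofReal (frobeniusNormSq (G z.1 z.2)) := lintegral_mono_set hcov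
      _ ≤ I.card * (ρ' * B) := lintegral_biUnion_finset_le_card_mul I _ _ hEi


/-! ### Step 2 tools: `L^p` bookkeeping -/

/-- `∫ ‖f‖ₑ^p ≤ M^p` from `‖f‖_{L^p} ≤ M` (`0 < p < ∞`). [folklore] -/
theorem lintegral_enorm_rpow_le_of_eLpNorm_le {α F : Type*} [MeasurableSpace α] {μ : Measure α}
    [NormedAddCommGroup F] {f : α → F} {q : ℝ≥0∞} (hq0 : q ≠ 0) (hqt : q ≠ ∞) {M : ℝ≥0∞}
    (h : eLpNorm f q μ ≤ M) : ∫⁻ x, ‖f x‖ₑ ^ q.toReal ∂μ ≤ M ^ q.toReal := by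
  have hq : 0 < q.toReal := ENNReal.toReal_pos hq0 hqt
  rw [lintegral_rpow_enorm_eq_rpow_eLpNorm' hq, ← eLpNorm_eq_eLpNorm' hq0 hqt]
  exact ENNReal.rpow_le_rpow h hq.le

/-- Weak convergence of `fₖ ψ` tested against `L³(S)` restricts to every measurable `T ⊆ S`
(test `𝟙_T ψ`). [folklore] -/
theorem tendsto_setIntegral_mul_of_subset {S T : Set (ℝ × (EuclideanSpace ℝ (Fin 3)))} (hT : MeasurableSet T)
    (hTS : T ⊆ S) {f : ℕ → ℝ × (EuclideanSpace ℝ (Fin 3)) → ℝ} {g : ℝ × (EuclideanSpace ℝ (Fin 3)) → ℝ}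
    (h : ∀ ψ : ℝ × (EuclideanSpace ℝ (Fin 3)) → ℝ, MemLp ψ 3 (volume.restrict S) →
      Tendsto (fun k => ∫ z in S, f k z * ψ z) atTop (𝓝 (∫ z in S, g z * ψ z)))
    (ψ : ℝ × (EuclideanSpace ℝ (Fin 3)) → ℝ) (hψ : MemLp ψ 3 (volume.restrict T)) :
    Tendsto (fun k => ∫ z in T, f k z * ψ z) atTop (𝓝 (∫ z in T, g z * ψ z)) := by
  have hψ' : MemLp (T.indicator ψ) 3 (volume.restrict S) := by
    rw [memLp_indicator_iff_restrict hT, Measure.restrict_restrict hT, inter_eq_left.2 hTS]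
    exact hψ
  have key : ∀ φ : ℝ × (EuclideanSpace ℝ (Fin 3)) → ℝ, ∫ z in S, φ z * T.indicator ψ z = ∫ z in T, φ z * ψ z := by
    intro φ
    have e : (fun z => φ z * T.indicator ψ z) = T.indicator (fun z => φ z * ψ z) := by
      funext z
      rw [Set.indicator_mul_right]
    rw [e, setIntegral_indicator hT, inter_eq_right.2 hTS]
  have h1 := h (T.indicator ψ) hψ'
  simp only [key] at h1
  exact h1

/-- **Restriction of the class of A–B's Def. 2.1 to a smaller concentric ball.** [folklore] -/
theorem isSuitableWeakSolutionInBall_of_le_radius {R R' : ℝ} {u : ℝ → (EuclideanSpace ℝ (Fin 3)) → (EuclideanSpace ℝ (Fin 3))} {p : ℝ → (EuclideanSpace ℝ (Fin 3)) → ℝ}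
    (h : IsSuitableWeakSolutionInBall R' 0 u p) (hR : 0 < R) (hRR' : R ≤ R') :
    IsSuitableWeakSolutionInBall R 0 u p := by
  obtain ⟨hsw, ⟨C, hC⟩, ⟨G, hG, hG2⟩, hp⟩ := h
  have hle := parabolicCylinderOpens_zero_mono hR.le hRR'
  have hsub := parabolicCylinder_zero_mono hR.le hRR'
  refine ⟨hsw.of_le hle, ⟨C, ?_⟩, ⟨G, hG.mono hle, lt_of_le_of_lt (lintegral_mono_set hsub) hG2⟩,
    hp.mono_measure (Measure.restrict_mono hsub le_rfl)⟩
  simp only [Prod.fst_zero, Prod.snd_zero, zero_sub] at hC ⊢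
  have hI : Ioo (-R ^ 2) (0 : ℝ) ⊆ Ioo (-R' ^ 2) 0 := by
    refine Ioo_subset_Ioo ?_ le_rfl
    have : R ^ 2 ≤ R' ^ 2 := pow_le_pow_left₀ hR.le hRR' 2
    linarith
  have hC' := ae_restrict_of_ae_restrict_of_subset hI hC
  filter_upwards [hC'] with t ht
  exact (lintegral_mono_set (ball_subset_ball hRR')).trans ht

/-! ### Step 3 tools: the uniform `L^{10/3}` bound on a parabolic ball -/

/-- **The uniform `L^{10/3}(Q(R))` bound** from the slice and gradient bounds (the embedding
`L^∞_t L²_x ∩ L²_t H¹_x ↪ L^{10/3}` of the proof of A–B Lemma 2.2; the tree's scale-invariant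
`exists_lintegral_tenThirds_backward_le`, Lemarié-Rieusset 2016, (13.18)). [cite: AlbrittonBarker2019, Lemma 2.2 (proof sketch, arXiv p. 5)] -/
theorem exists_tenThirds_bound {R : ℝ} (hR : 0 < R) (C : ℝ≥0) :
    ∃ M : ℝ≥0∞, M ≠ ∞ ∧ ∀ (u : ℝ → (EuclideanSpace ℝ (Fin 3)) → (EuclideanSpace ℝ (Fin 3))) (G : ℝ → (EuclideanSpace ℝ (Fin 3)) → (EuclideanSpace ℝ (Fin 3)) →L[ℝ] (EuclideanSpace ℝ (Fin 3))),
      HasWeakSpatialGradientOn (parabolicCylinderOpens R (0 : ℝ × (EuclideanSpace ℝ (Fin 3)))) u G →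
      (∀ᵐ t ∂(volume.restrict (Ioo (-R ^ 2) 0)), ∫⁻ x in ball (0 : (EuclideanSpace ℝ (Fin 3))) R, ‖u t x‖ₑ ^ 2 ≤ C) →
      ∫⁻ z in parabolicCylinder R (0 : ℝ × (EuclideanSpace ℝ (Fin 3))), ENNReal.ofReal (frobeniusNormSq (G z.1 z.2)) ≤ C →
      ∫⁻ z in parabolicCylinder R (0 : ℝ × (EuclideanSpace ℝ (Fin 3))), ‖u z.1 z.2‖ₑ ^ (10 / 3 : ℝ) ≤ M := by
  obtain ⟨K, hK⟩ := exists_lintegral_tenThirds_backward_le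
  set A : ℝ≥0∞ := (ENNReal.ofReal R)⁻¹ * C with hA
  have hAtop : A ≠ ∞ :=
    ENNReal.mul_ne_top (ENNReal.inv_ne_top.2 (ENNReal.ofReal_pos.2 hR).ne') ENNReal.coe_ne_top
  refine ⟨K * ENNReal.ofReal (R ^ (5 / 3 : ℝ)) * A ^ (2 / 3 : ℝ) * (A + A), ?_,
    fun u G hG hE hGb => ?_⟩
  · refine ENNReal.mul_ne_top (ENNReal.mul_ne_top (ENNReal.mul_ne_top ENNReal.coe_ne_top
      ENNReal.ofReal_ne_top) (ENNReal.rpow_ne_top_of_nonneg (by norm_num) hAtop)) ?_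
    exact ENNReal.add_ne_top.2 ⟨hAtop, hAtop⟩
  · have hAe : cknAEss R 0 u ≤ A := by
      rw [cknAEss]
      refine essSup_le_of_ae_le _ ?_
      simp only [Prod.fst_zero, Prod.snd_zero, zero_sub]
      filter_upwards [hE] with t ht
      exact mul_le_mul_right ht _
    have hEe : cknE R 0 G ≤ A := by
      rw [cknE]
      exact mul_le_mul_right hGb _
    refine (hK u G 0 R hR hG (ne_top_of_le_ne_top hAtop hAe)
      (ne_top_of_le_ne_top hAtop hEe)).trans ?_
    gcongr

/-! ### Step 3: the velocities — Aubin–Lions on each ball, diagonal subsequence, gluing -/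

/-- **One subsequence and one limit for the velocities on all the balls `Q(ρ_n)`**
(Albritton–Barker 2019, proof of Lemma 2.2, "the Aubin–Lions lemma"; the bookkeeping of
Seregin 2014, App. B §B.4: Aubin–Lions on each cylinder, Cantor's diagonal procedure, gluing of
the a.e.-unique `L²` limits). Let `(V_k, P_k)` be distributional solutions on `Q = Q(0, 1)` with
weak spatial gradients `G_k`, and `0 < ρ_n ≤ 1` nondecreasing radii with uniform bounds
`∫_{B(0,ρ_n)} |V_k(t)|² ≤ C_n` (a.e. `t ∈ ]-ρ_n², 0[`), `∫_{Q(ρ_n)} |G_k|² ≤ C_n`,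
`∫_{Q(ρ_n)} |P_k|^{3/2} ≤ M_p`. Then along one subsequence `φ` the `V_{φ k}` converge in
`L²(Q(ρ_n))`, for every `n`, to one field `u`, measurable on each `Q(ρ_n)` with
`∫_{B(0,ρ_n)} |u(t)|² ≤ C_n` for a.e. `t`. [cite: AlbrittonBarker2019, Lemma 2.2 (proof sketch, arXiv p. 5)] -/
theorem velocity_extraction {ρ : ℕ → ℝ} (hρ0 : ∀ n, 0 < ρ n) (hρ1 : ∀ n, ρ n ≤ 1)
    (hρm : Monotone ρ) {V : ℕ → ℝ → (EuclideanSpace ℝ (Fin 3)) → (EuclideanSpace ℝ (Fin 3))} {P : ℕ → ℝ → (EuclideanSpace ℝ (Fin 3)) → ℝ}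
    {GV : ℕ → ℝ → (EuclideanSpace ℝ (Fin 3)) → (EuclideanSpace ℝ (Fin 3)) →L[ℝ] (EuclideanSpace ℝ (Fin 3))}
    (hsol : ∀ k, IsDistributionalNSSolutionOn (parabolicCylinderOpens 1 (0 : ℝ × (EuclideanSpace ℝ (Fin 3)))) 1 0 (V k) (P k))
    (hG : ∀ k, HasWeakSpatialGradientOn (parabolicCylinderOpens 1 (0 : ℝ × (EuclideanSpace ℝ (Fin 3)))) (V k) (GV k))
    {C : ℕ → ℝ≥0} {Mp : ℝ≥0∞} (hMp : Mp ≠ ∞)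
    (hE : ∀ n k, ∀ᵐ t ∂(volume.restrict (Ioo (-(ρ n) ^ 2) 0)),
      ∫⁻ x in ball (0 : (EuclideanSpace ℝ (Fin 3))) (ρ n), ‖V k t x‖ₑ ^ 2 ≤ C n)
    (hGb : ∀ n k, ∫⁻ z in parabolicCylinder (ρ n) (0 : ℝ × (EuclideanSpace ℝ (Fin 3))),
      ENNReal.ofReal (frobeniusNormSq (GV k z.1 z.2)) ≤ C n)
    (hPb : ∀ n k, ∫⁻ z in parabolicCylinder (ρ n) (0 : ℝ × (EuclideanSpace ℝ (Fin 3))),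
      ‖P k z.1 z.2‖ₑ ^ (3 / 2 : ℝ) ≤ Mp) :
    ∃ (φ : ℕ → ℕ) (u : ℝ → (EuclideanSpace ℝ (Fin 3)) → (EuclideanSpace ℝ (Fin 3))), StrictMono φ ∧ ∀ n,
      AEStronglyMeasurable (uncurry u) (volume.restrict (parabolicCylinder (ρ n) (0 : ℝ × (EuclideanSpace ℝ (Fin 3))))) ∧
      (∀ᵐ t ∂(volume.restrict (Ioo (-(ρ n) ^ 2) 0)),
        ∫⁻ x in ball (0 : (EuclideanSpace ℝ (Fin 3))) (ρ n), ‖u t x‖ₑ ^ 2 ≤ C n) ∧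
      Tendsto (fun k => ∫⁻ z in parabolicCylinder (ρ n) (0 : ℝ × (EuclideanSpace ℝ (Fin 3))),
        ‖V (φ k) z.1 z.2 - u z.1 z.2‖ₑ ^ 2) atTop (𝓝 0) := by
  classical
  -- the balls `S n = Q(ρ n)`
  set S : ℕ → Set (ℝ × (EuclideanSpace ℝ (Fin 3))) := fun n => parabolicCylinder (ρ n) (0 : ℝ × (EuclideanSpace ℝ (Fin 3))) with hS
  have hSm : ∀ n, MeasurableSet (S n) := fun n => (isOpen_parabolicCylinder _ _).measurableSet
  have hSmono : ∀ {n m : ℕ}, n ≤ m → S n ⊆ S m := fun {n m} h =>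
    parabolicCylinder_zero_mono (hρ0 n).le (hρm h)
  have hS1 : ∀ n, S n ⊆ parabolicCylinder 1 (0 : ℝ × (EuclideanSpace ℝ (Fin 3))) := fun n =>
    parabolicCylinder_zero_mono (hρ0 n).le (hρ1 n)
  have hle : ∀ n, parabolicCylinderOpens (ρ n) (0 : ℝ × (EuclideanSpace ℝ (Fin 3))) ≤
      parabolicCylinderOpens 1 (0 : ℝ × (EuclideanSpace ℝ (Fin 3))) := fun n =>
    parabolicCylinderOpens_zero_mono (hρ0 n).le (hρ1 n)
  have hleT : ∀ n, timeCylinder (⟨ball (0 : (EuclideanSpace ℝ (Fin 3))) (ρ n), isOpen_ball⟩ : Opens (EuclideanSpace ℝ (Fin 3))) (-(ρ n) ^ 2) 0 ≤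
      parabolicCylinderOpens 1 (0 : ℝ × (EuclideanSpace ℝ (Fin 3))) := fun n => by
    rw [timeCylinder_ball_eq]
    exact hle n
  have hCtop : ∀ n, ((C n : ℝ≥0) : ℝ≥0∞) ≠ ∞ := fun n => ENNReal.coe_ne_top
  -- measurability of the `V k` on the balls
  have hVm : ∀ k n, AEStronglyMeasurable (uncurry (V k)) (volume.restrict (S n)) := fun k n =>
    ((hsol k).1.aestronglyMeasurable).mono_measure (Measure.restrict_mono (hS1 n) le_rfl)
  -- the extraction property on `S n`
  let Pr : ℕ → (ℕ → ℕ) → Prop := fun n φ =>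
    ∃ w : ℝ → (EuclideanSpace ℝ (Fin 3)) → (EuclideanSpace ℝ (Fin 3)), AEStronglyMeasurable (uncurry w) (volume.restrict (S n)) ∧
      (∀ᵐ t ∂(volume.restrict (Ioo (-(ρ n) ^ 2) 0)),
        ∫⁻ x in ball (0 : (EuclideanSpace ℝ (Fin 3))) (ρ n), ‖w t x‖ₑ ^ 2 ≤ C n) ∧
      Tendsto (fun k => ∫⁻ z in S n, ‖V (φ k) z.1 z.2 - w z.1 z.2‖ₑ ^ 2) atTop (𝓝 0)
  have hsub : ∀ n (φ φ' : ℕ → ℕ), (∃ τ : ℕ → ℕ, StrictMono τ ∧ ∀ᶠ k in atTop, φ' k = φ (τ k)) →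
      Pr n φ → Pr n φ' := by
    rintro n φ φ' ⟨τ, hτ, heq⟩ ⟨w, hwm, hwb, hwt⟩
    exact ⟨w, hwm, hwb, FunctionSpaces.tendsto_of_eventually_eq_comp
      (a := fun j => ∫⁻ z in S n, ‖V j z.1 z.2 - w z.1 z.2‖ₑ ^ 2) hτ heq hwt⟩
  have hex : ∀ n (φ : ℕ → ℕ), StrictMono φ → ∃ ψ : ℕ → ℕ, StrictMono ψ ∧ Pr n (φ ∘ ψ) := by
    intro n φ _hφ
    have hEx : ∀ k, ∀ᵐ t ∂(volume.restrict (Ioo (-(ρ n) ^ 2) 0)),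
        ∫⁻ x in ball (0 : (EuclideanSpace ℝ (Fin 3))) (ρ n), ‖V (φ k) t x‖ₑ ^ 2 ≤ (C n : ℝ≥0∞) := fun k => hE n (φ k)
    have hGx : ∀ k, ∃ G : ℝ → (EuclideanSpace ℝ (Fin 3)) → (EuclideanSpace ℝ (Fin 3)) →L[ℝ] (EuclideanSpace ℝ (Fin 3)),
        HasWeakSpatialGradientOn
          (timeCylinder (⟨ball (0 : (EuclideanSpace ℝ (Fin 3))) (ρ n), isOpen_ball⟩ : Opens (EuclideanSpace ℝ (Fin 3))) (-(ρ n) ^ 2) 0) (V (φ k)) G ∧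
        ∫⁻ z in Ioo (-(ρ n) ^ 2) 0 ×ˢ ball (0 : (EuclideanSpace ℝ (Fin 3))) (ρ n),
          ENNReal.ofReal (frobeniusNormSq (G z.1 z.2)) ≤ (C n : ℝ≥0∞) := fun k =>
      ⟨GV (φ k), (hG (φ k)).mono (hleT n), by rw [← parabolicCylinder_zero]; exact hGb n (φ k)⟩
    have hPx : ∀ k, ∫⁻ z in Ioo (-(ρ n) ^ 2) 0 ×ˢ ball (0 : (EuclideanSpace ℝ (Fin 3))) (ρ n),
        ‖P (φ k) z.1 z.2‖ₑ ^ (3 / 2 : ℝ) ≤ Mp := fun k => by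
      rw [← parabolicCylinder_zero]; exact hPb n (φ k)
    obtain ⟨σ, w, hσ, hwm, hwb, hwt, -⟩ :=
      NSCylinder.exists_subseq_strong_limit_velocity_ball (0 : (EuclideanSpace ℝ (Fin 3))) (ρ n) (a := -(ρ n) ^ 2) (b := 0)
        (v := fun k => V (φ k)) (π := fun k => P (φ k)) (hCtop n) (hCtop n) hMp
        (fun k => ((hsol (φ k)).mono_holds (hleT n))) hEx hGx hPx
    refine ⟨σ, hσ, w, ?_, hwb, ?_⟩
    · rw [hS]; dsimp only; rw [parabolicCylinder_zero]; exact hwm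
    · have e : S n = Ioo (-(ρ n) ^ 2) 0 ×ˢ ball (0 : (EuclideanSpace ℝ (Fin 3))) (ρ n) := parabolicCylinder_zero _
      simpa only [e, comp_apply] using hwt
  obtain ⟨φ, hφ, hP⟩ := FunctionSpaces.exists_strictMono_forall_of_extraction hsub hex
  choose w hwm hwb hwt using hP
  -- the limits agree on the smaller balls
  have hcons : ∀ n m, n ≤ m → ∀ᵐ z ∂(volume.restrict (S n)), uncurry (w n) z = uncurry (w m) z := by
    intro n m hnm
    have hwt' : Tendsto (fun k => ∫⁻ z in S n, ‖V (φ k) z.1 z.2 - w m z.1 z.2‖ₑ ^ 2) atTop (𝓝 0) :=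
      tendsto_of_tendsto_of_tendsto_of_le_of_le tendsto_const_nhds (hwt m) (fun _ => bot_le)
        fun _ => lintegral_mono_set (hSmono hnm)
    exact Seregin2014Limit.ae_eq_of_tendsto_lintegral_sub_sq (f := fun k => uncurry (V (φ k)))
      (fun k => hVm (φ k) n) (hwm n)
      ((hwm m).mono_measure (Measure.restrict_mono (hSmono hnm) le_rfl)) (hwt n) hwt'
  -- glue along the least index
  let N : ℝ × (EuclideanSpace ℝ (Fin 3)) → ℕ := fun z => if h : ∃ n, z ∈ S n then Nat.find h else 0
  have hNS : ∀ z ∈ ⋃ n, S n, z ∈ S (N z) := by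
    intro z hz
    have h : ∃ n, z ∈ S n := mem_iUnion.1 hz
    simp only [N, dif_pos h]
    exact Nat.find_spec h
  have hNle : ∀ n, ∀ z ∈ S n, N z ≤ n := by
    intro n z hz
    have h : ∃ n, z ∈ S n := ⟨n, hz⟩
    simp only [N, dif_pos h]
    exact Nat.find_min' h hz
  obtain ⟨U, hU, -⟩ := FunctionSpaces.exists_glue_of_ae_eq (μ := (volume : Measure (ℝ × (EuclideanSpace ℝ (Fin 3)))))
    hSm N hNS hNle (fun n => uncurry (w n)) hcons
  set u : ℝ → (EuclideanSpace ℝ (Fin 3)) → (EuclideanSpace ℝ (Fin 3)) := fun t x => U (t, x) with hu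
  have hum : ∀ n, AEStronglyMeasurable (uncurry u) (volume.restrict (S n)) := fun n =>
    (hwm n).congr ((hU n).mono fun z hz => by
      change uncurry (w n) z = U (z.1, z.2)
      rw [← hz])
  refine ⟨φ, u, hφ, fun n => ⟨hum n, ?_, ?_⟩⟩
  · -- the slice bounds transfer from `w n` to `u`
    have h1 := ae_ae_of_ae_prod_restrict (a := -(ρ n) ^ 2) (b := 0) (B := ball (0 : (EuclideanSpace ℝ (Fin 3))) (ρ n))
      (P := fun z => U z = uncurry (w n) z) (by rw [← parabolicCylinder_zero]; exact hU n)
    filter_upwards [hwb n, h1] with t ht ht'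
    refine le_of_eq_of_le (lintegral_congr_ae ?_) ht
    filter_upwards [ht'] with x hx
    change ‖U (t, x)‖ₑ ^ 2 = ‖uncurry (w n) (t, x)‖ₑ ^ 2
    rw [hx]
  · refine (hwt n).congr fun k => lintegral_congr_ae ?_
    filter_upwards [hU n] with z hz
    change ‖V (φ k) z.1 z.2 - uncurry (w n) z‖ₑ ^ 2 = ‖V (φ k) z.1 z.2 - U (z.1, z.2)‖ₑ ^ 2
    rw [← hz]


/-! ### Step 4: suitability of the limit on one ball -/

/-- **The limit is a suitable weak solution in the ball `Q(R)`** (Albritton–Barker 2019, Lemma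
2.2: "there exists a suitable weak solution `(u, p)` on `Q(R)` for all `0 < R < 1`"; Lin 1998,
Thm. 2.2; CKN 1982, §2). On `S = Q(R)`, `R ≤ 1`: let `(V_k, P_k)` be suitable weak solutions on
`Q` with weak spatial gradients `G_k`, uniform bounds `∫_{B_R} |V_k(t)|² ≤ C`, `∫_S |G_k|² ≤ C`,
`∫_S |P_k|^{3/2} ≤ M_p`, `V_k → u` in `L²(S)` for a measurable `u` with the same slice bound, and
`P_k ⇀ p` weakly in `L^{3/2}(S)` with `∫_S |p|^{3/2} ≤ M_p`. Then `(u, p)` is in the class of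
A–B's Def. 2.1 on `Q(R)`, `u ∈ L³(S)` and `V_k → u` in `L³(S)`: the uniform `L^{10/3}` bound
(`exists_tenThirds_bound`) upgrades the convergence to `L³`, a subsequence of the gradients
converges weakly in `L²(S)` to a weak spatial gradient of `u`
(`exists_hasWeakSpatialGradientOn_of_weakGradient_approx_L2`), and suitability passes to the
limit (`isSuitableWeakSolutionOn_of_tendsto`). [cite: AlbrittonBarker2019, Lemma 2.2 (arXiv p. 5)] -/
theorem limit_isSuitableWeakSolutionInBall {R : ℝ} (hR0 : 0 < R) (hR1 : R ≤ 1)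
    {V : ℕ → ℝ → (EuclideanSpace ℝ (Fin 3)) → (EuclideanSpace ℝ (Fin 3))} {P : ℕ → ℝ → (EuclideanSpace ℝ (Fin 3)) → ℝ} {GV : ℕ → ℝ → (EuclideanSpace ℝ (Fin 3)) → (EuclideanSpace ℝ (Fin 3)) →L[ℝ] (EuclideanSpace ℝ (Fin 3))}
    {u : ℝ → (EuclideanSpace ℝ (Fin 3)) → (EuclideanSpace ℝ (Fin 3))} {p : ℝ → (EuclideanSpace ℝ (Fin 3)) → ℝ} {C : ℝ≥0} {Mp : ℝ≥0∞} (hMp : Mp ≠ ∞)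
    (hsw : ∀ k, IsSuitableWeakSolutionOn (parabolicCylinderOpens 1 (0 : ℝ × (EuclideanSpace ℝ (Fin 3)))) 1 0 (V k) (P k))
    (hG : ∀ k, HasWeakSpatialGradientOn (parabolicCylinderOpens 1 (0 : ℝ × (EuclideanSpace ℝ (Fin 3)))) (V k) (GV k))
    (hE : ∀ k, ∀ᵐ t ∂(volume.restrict (Ioo (-R ^ 2) 0)),
      ∫⁻ x in ball (0 : (EuclideanSpace ℝ (Fin 3))) R, ‖V k t x‖ₑ ^ 2 ≤ C)
    (hGb : ∀ k, ∫⁻ z in parabolicCylinder R (0 : ℝ × (EuclideanSpace ℝ (Fin 3))),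
      ENNReal.ofReal (frobeniusNormSq (GV k z.1 z.2)) ≤ C)
    (hPb : ∀ k, ∫⁻ z in parabolicCylinder R (0 : ℝ × (EuclideanSpace ℝ (Fin 3))), ‖P k z.1 z.2‖ₑ ^ (3 / 2 : ℝ) ≤ Mp)
    (hum : AEStronglyMeasurable (uncurry u) (volume.restrict (parabolicCylinder R (0 : ℝ × (EuclideanSpace ℝ (Fin 3))))))
    (huE : ∀ᵐ t ∂(volume.restrict (Ioo (-R ^ 2) 0)), ∫⁻ x in ball (0 : (EuclideanSpace ℝ (Fin 3))) R, ‖u t x‖ₑ ^ 2 ≤ C)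
    (hconv : Tendsto (fun k => ∫⁻ z in parabolicCylinder R (0 : ℝ × (EuclideanSpace ℝ (Fin 3))),
      ‖V k z.1 z.2 - u z.1 z.2‖ₑ ^ 2) atTop (𝓝 0))
    (hpm : AEStronglyMeasurable (uncurry p) (volume.restrict (parabolicCylinder R (0 : ℝ × (EuclideanSpace ℝ (Fin 3))))))
    (hpb : ∫⁻ z in parabolicCylinder R (0 : ℝ × (EuclideanSpace ℝ (Fin 3))), ‖p z.1 z.2‖ₑ ^ (3 / 2 : ℝ) ≤ Mp)
    (hπw : ∀ g : ℝ × (EuclideanSpace ℝ (Fin 3)) → ℝ, MemLp g 3 (volume.restrict (parabolicCylinder R (0 : ℝ × (EuclideanSpace ℝ (Fin 3))))) →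
      Tendsto (fun k => ∫ z in parabolicCylinder R (0 : ℝ × (EuclideanSpace ℝ (Fin 3))), P k z.1 z.2 * g z) atTop
        (𝓝 (∫ z in parabolicCylinder R (0 : ℝ × (EuclideanSpace ℝ (Fin 3))), p z.1 z.2 * g z))) :
    IsSuitableWeakSolutionInBall R 0 u p ∧
      MemLp (uncurry u) 3 (volume.restrict (parabolicCylinder R (0 : ℝ × (EuclideanSpace ℝ (Fin 3))))) ∧
      Tendsto (fun k => eLpNorm (uncurry (V k) - uncurry u) 3
        (volume.restrict (parabolicCylinder R (0 : ℝ × (EuclideanSpace ℝ (Fin 3)))))) atTop (𝓝 0) := by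
  set S : Set (ℝ × (EuclideanSpace ℝ (Fin 3))) := parabolicCylinder R (0 : ℝ × (EuclideanSpace ℝ (Fin 3))) with hS
  set Ω : Opens (ℝ × (EuclideanSpace ℝ (Fin 3))) := parabolicCylinderOpens R (0 : ℝ × (EuclideanSpace ℝ (Fin 3))) with hΩ
  have hΩS : ((Ω : Opens (ℝ × (EuclideanSpace ℝ (Fin 3)))) : Set (ℝ × (EuclideanSpace ℝ (Fin 3)))) = S := rfl
  have hle : Ω ≤ parabolicCylinderOpens 1 (0 : ℝ × (EuclideanSpace ℝ (Fin 3))) := parabolicCylinderOpens_zero_mono hR0.le hR1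
  have hS1 : S ⊆ parabolicCylinder 1 (0 : ℝ × (EuclideanSpace ℝ (Fin 3))) := parabolicCylinder_zero_mono hR0.le hR1
  have hSfin : volume S ≠ ∞ := volume_parabolicCylinder_zero_ne_top R
  haveI : IsFiniteMeasure (volume.restrict S) := isFiniteMeasure_restrict_parabolicCylinder_zero R
  have hCtop : ((C : ℝ≥0) : ℝ≥0∞) ≠ ∞ := ENNReal.coe_ne_top
  have hVm : ∀ k, AEStronglyMeasurable (uncurry (V k)) (volume.restrict S) := fun k =>
    ((hsw k).distributional.1.aestronglyMeasurable).mono_measure (Measure.restrict_mono hS1 le_rfl)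
  -- the uniform `L^{10/3}` bound, `L³` convergence and the `L³` classes
  obtain ⟨M, hMtop, hM⟩ := exists_tenThirds_bound hR0 C
  have h103 : ∀ k, ∫⁻ z in S, ‖V k z.1 z.2‖ₑ ^ (10 / 3 : ℝ) ≤ M := fun k =>
    hM (V k) (GV k) ((hG k).mono hle) (hE k) (hGb k)
  have hL3 : Tendsto (fun k => eLpNorm (uncurry (V k) - uncurry u) 3 (volume.restrict S)) atTop
      (𝓝 0) :=
    FunctionSpaces.tendsto_eLpNorm_three_of_sq_of_tenThirds (f := fun k => uncurry (V k))
      (g := uncurry u) hVm hum hconv hMtop h103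
  have hu3 : MemLp (uncurry u) 3 (volume.restrict S) :=
    FunctionSpaces.memLp_three_limit_of_sq_of_tenThirds (f := fun k => uncurry (V k))
      (g := uncurry u) hVm hum hconv hMtop h103
  have hv3 : ∀ k, MemLp (uncurry (V k)) 3 (volume.restrict S) := fun k =>
    FunctionSpaces.memLp_three_of_lintegral_tenThirds_le (hVm k) hMtop (h103 k)
  have hu1 : LocallyIntegrableOn (uncurry u) ((Ω : Opens (ℝ × (EuclideanSpace ℝ (Fin 3)))) : Set (ℝ × (EuclideanSpace ℝ (Fin 3)))) volume := by
    rw [hΩS]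
    have hi : IntegrableOn (uncurry u) S volume := hu3.integrable (by norm_num)
    exact hi.locallyIntegrableOn
  -- `L¹` convergence on compact subsets, for the weak limit of the gradients
  have h2S : Tendsto (fun k => eLpNorm (uncurry (V k) - uncurry u) 2 (volume.restrict S)) atTop
      (𝓝 0) :=
    FunctionSpaces.tendsto_eLpNorm_two_of_tendsto_lintegral_sq (f := fun k => uncurry (V k))
      (g := uncurry u) hconv
  have hconv1 : ∀ K ⊆ ((Ω : Opens (ℝ × (EuclideanSpace ℝ (Fin 3)))) : Set (ℝ × (EuclideanSpace ℝ (Fin 3)))), IsCompact K →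
      Tendsto (fun k => eLpNorm (fun z => uncurry (V k) z - uncurry u z) 1 (volume.restrict K))
        atTop (𝓝 0) := by
    intro K hKS hKc
    rw [hΩS] at hKS
    have hKfin : volume K ≠ ∞ := hKc.measure_lt_top.ne
    have hbound : ∀ k, eLpNorm (fun z => uncurry (V k) z - uncurry u z) 1 (volume.restrict K) ≤
        volume K ^ (1 / 2 : ℝ) * eLpNorm (uncurry (V k) - uncurry u) 2 (volume.restrict S) := by
      intro k
      have hm : AEStronglyMeasurable (uncurry (V k) - uncurry u) (volume.restrict K) :=
        ((hVm k).sub hum).mono_measure (Measure.restrict_mono hKS le_rfl)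
      calc eLpNorm (fun z => uncurry (V k) z - uncurry u z) 1 (volume.restrict K)
          = ∫⁻ z in K, ‖(uncurry (V k) - uncurry u) z‖ₑ := by
            rw [eLpNorm_one_eq_lintegral_enorm]; rfl
        _ ≤ (volume.restrict K) univ ^ (1 / 2 : ℝ) *
              eLpNorm (uncurry (V k) - uncurry u) 2 (volume.restrict K) :=
            lintegral_enorm_le_measure_univ_mul_eLpNorm_two hm
        _ ≤ volume K ^ (1 / 2 : ℝ) * eLpNorm (uncurry (V k) - uncurry u) 2 (volume.restrict S) := by
            rw [Measure.restrict_apply_univ]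
            gcongr
    have hlim : Tendsto (fun k => volume K ^ (1 / 2 : ℝ) *
        eLpNorm (uncurry (V k) - uncurry u) 2 (volume.restrict S)) atTop (𝓝 0) := by
      have h := ENNReal.Tendsto.const_mul h2S (a := volume K ^ (1 / 2 : ℝ))
        (Or.inr (ENNReal.rpow_ne_top_of_nonneg (by norm_num) hKfin))
      rwa [mul_zero] at h
    exact tendsto_of_tendsto_of_tendsto_of_le_of_le tendsto_const_nhds hlim (fun _ => zero_le)
      hbound
  obtain ⟨Gu, κ, hκ, hGuW, -, hGub, hGweak, -, -⟩ :=
    exists_hasWeakSpatialGradientOn_of_weakGradient_approx_L2 (Ω := Ω) (u := u) hu1 (V := V)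
      (Gn := GV) (fun k => (hG k).mono hle) hconv1 hCtop (fun k => by rw [hΩS]; exact hGb k)
  -- the energy class of the limit in the indicator form
  have huEK : ∀ K ⊆ ((Ω : Opens (ℝ × (EuclideanSpace ℝ (Fin 3)))) : Set (ℝ × (EuclideanSpace ℝ (Fin 3)))), IsCompact K → ∃ C' : ℝ≥0, ∀ᵐ t : ℝ,
      ∫⁻ x, K.indicator (fun z : ℝ × (EuclideanSpace ℝ (Fin 3)) => ‖u z.1 z.2‖ₑ ^ 2) (t, x) ≤ C' := by
    intro K hKS _hKc
    rw [hΩS] at hKS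
    refine ⟨C, ?_⟩
    have h1 : ∀ᵐ t : ℝ, t ∈ Ioo (-R ^ 2) 0 → ∫⁻ x in ball (0 : (EuclideanSpace ℝ (Fin 3))) R, ‖u t x‖ₑ ^ 2 ≤ C :=
      (ae_restrict_iff' measurableSet_Ioo).1 huE
    filter_upwards [h1] with t ht
    by_cases htI : t ∈ Ioo (-R ^ 2) 0
    · calc ∫⁻ x, K.indicator (fun z : ℝ × (EuclideanSpace ℝ (Fin 3)) => ‖u z.1 z.2‖ₑ ^ 2) (t, x)
          ≤ ∫⁻ x, (ball (0 : (EuclideanSpace ℝ (Fin 3))) R).indicator (fun x => ‖u t x‖ₑ ^ 2) x := by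
            refine lintegral_mono fun x => ?_
            by_cases hx : (t, x) ∈ K
            · have hxB : x ∈ ball (0 : (EuclideanSpace ℝ (Fin 3))) R := by
                have h := hKS hx
                rw [hS, mem_parabolicCylinder_zero] at h
                exact mem_ball_zero_iff.2 h.2
              rw [indicator_of_mem hx, indicator_of_mem hxB]
            · rw [indicator_of_notMem hx]
              exact zero_le
        _ = ∫⁻ x in ball (0 : (EuclideanSpace ℝ (Fin 3))) R, ‖u t x‖ₑ ^ 2 := lintegral_indicator measurableSet_ball _
        _ ≤ C := ht htI
    · have h0 : ∀ x, K.indicator (fun z : ℝ × (EuclideanSpace ℝ (Fin 3)) => ‖u z.1 z.2‖ₑ ^ 2) (t, x) = 0 := fun x =>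
        indicator_of_notMem (fun hx => htI (by
          have h := hKS hx
          rw [hS, mem_parabolicCylinder_zero] at h
          exact h.1)) _
      simp only [h0, lintegral_const, zero_mul]
      exact zero_le
  -- stability of suitability along the subsequence `κ`
  have hsuitu : IsSuitableWeakSolutionOn Ω 1 0 u p :=
    isSuitableWeakSolutionOn_of_tendsto (Q := Ω) hSfin zero_le_one
      (v := fun k => V (κ k)) (π := fun k => P (κ k)) (G := fun k => GV (κ k)) (u := u) (p := p)
      (Gu := Gu) (Cp := Mp) hMp (fun k => (hsw _).of_le hle) (fun k => (hG _).mono hle)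
      (fun k => hv3 _) (fun k => hPb _) hu3 hpm hpb hGuW (hGub.trans_lt ENNReal.coe_lt_top) huEK
      (hL3.comp hκ.tendsto_atTop) (fun g hg => (hπw g hg).comp hκ.tendsto_atTop) hGweak
  refine ⟨⟨hsuitu, ⟨C, ?_⟩, ⟨Gu, hGuW, hGub.trans_lt ENNReal.coe_lt_top⟩, ?_⟩, hu3, hL3⟩
  · simp only [Prod.fst_zero, Prod.snd_zero, zero_sub]
    exact huE
  · exact (memLp_threeHalves_of_lintegral_le hpm hMp hpb).1

/-! ### The radii `ρ_n = 1 - 1/(n+2)` of the exhausting balls `Q(ρ_n) ↑ Q` -/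

/-- `ρ_n = 1 - 1/(n+2) > 0`. [folklore] -/
theorem radius_pos (n : ℕ) : 0 < 1 - 1 / ((n : ℝ) + 2) := by
  rw [sub_pos, div_lt_one (by positivity)]
  have hn : (0 : ℝ) ≤ n := n.cast_nonneg
  linarith

/-- `ρ_n < 1`. [folklore] -/
theorem radius_lt_one (n : ℕ) : 1 - 1 / ((n : ℝ) + 2) < 1 :=
  sub_lt_self _ (by positivity)

/-- `ρ_n` is nondecreasing. [folklore] -/
theorem monotone_radius : Monotone fun n : ℕ => 1 - 1 / ((n : ℝ) + 2) := by
  intro n m h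
  dsimp only
  have h1 : (1 : ℝ) / ((m : ℝ) + 2) ≤ 1 / ((n : ℝ) + 2) :=
    one_div_le_one_div_of_le (by positivity) (by
      have h' : (n : ℝ) ≤ m := Nat.cast_le.2 h
      linarith)
  linarith

/-- Every `R < 1` lies below some `ρ_n`. [folklore] -/
theorem exists_le_radius {R : ℝ} (hR : R < 1) : ∃ n : ℕ, R ≤ 1 - 1 / ((n : ℝ) + 2) := by
  obtain ⟨n, hn⟩ := exists_nat_gt (1 / (1 - R))
  refine ⟨n, ?_⟩
  have h1R : 0 < 1 - R := by linarith
  have hpos : 0 < 1 / (1 - R) := by positivity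
  have h2 : 1 / ((n : ℝ) + 2) < 1 - R := by
    have h3 : 1 / (1 - R) < (n : ℝ) + 2 := by linarith
    have h4 := one_div_lt_one_div_of_lt hpos h3
    rwa [one_div_one_div] at h4
  linarith

end SuitableCompactness

/-- **Albritton–Barker 2019, Lemma 2.2 (compactness of suitable weak solutions; "proven in
[Lin 1998]", Lin 1998, Thm. 2.2) — discharge of the named fact `SuitableCompactness`.** Let
`(v^{(k)}, q^{(k)})` be suitable weak solutions on `Q = Q(0, 1)` (A–B Def. 2.1) with
`sup_k ‖v^{(k)}‖_{L³(Q)} + ‖q^{(k)}‖_{L^{3/2}(Q)} < ∞`. Then along a subsequence `v^{(k)} → u` in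
`L³(Q(R))` and `q^{(k)} ⇀ p` weakly in `L^{3/2}(Q(R))` for every `0 < R < 1`, where `(u, p)` is
a suitable weak solution on every `Q(R)`. Proof (A–B: "the local energy inequality, the
embedding `L^∞_t L²_x ∩ L²_t H¹_x ↪ L^{10/3}`, and the Aubin–Lions lemma"): uniform local energy
bounds (`SuitableCompactness.exists_uniform_energy_bounds`), weak `L^{3/2}` compactness of the
pressures, Aubin–Lions with a diagonal subsequence for the velocities
(`SuitableCompactness.velocity_extraction`), and stability of suitability on each ball
(`SuitableCompactness.limit_isSuitableWeakSolutionInBall`); see the module docstring.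
[cite: AlbrittonBarker2019, Lemma 2.2 (arXiv p. 5)] -/
theorem SuitableCompactness_holds : SuitableCompactness := by
  intro v q hsw hbd
  -- ## notation and the uniform bound
  set Q₁ : Set (ℝ × (EuclideanSpace ℝ (Fin 3))) := parabolicCylinder 1 (0 : ℝ × (EuclideanSpace ℝ (Fin 3))) with hQ₁
  set M : ℝ≥0∞ := ⨆ k, (eLpNorm (uncurry (v k)) 3 (volume.restrict Q₁) +
      eLpNorm (uncurry (q k)) (3 / 2) (volume.restrict Q₁)) with hM
  have hMtop : M ≠ ∞ := hbd.ne
  have hv3 : ∀ k, eLpNorm (uncurry (v k)) 3 (volume.restrict Q₁) ≤ M := fun k =>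
    le_trans le_self_add (le_iSup (fun k => eLpNorm (uncurry (v k)) 3 (volume.restrict Q₁) +
      eLpNorm (uncurry (q k)) (3 / 2) (volume.restrict Q₁)) k)
  have hq32 : ∀ k, eLpNorm (uncurry (q k)) (3 / 2) (volume.restrict Q₁) ≤ M := fun k =>
    le_trans le_add_self (le_iSup (fun k => eLpNorm (uncurry (v k)) 3 (volume.restrict Q₁) +
      eLpNorm (uncurry (q k)) (3 / 2) (volume.restrict Q₁)) k)
  set Mu : ℝ≥0∞ := M ^ 3 with hMu
  set Mp : ℝ≥0∞ := M ^ (3 / 2 : ℝ) with hMp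
  have hMut : Mu ≠ ∞ := ENNReal.pow_ne_top hMtop
  have hMpt : Mp ≠ ∞ := ENNReal.rpow_ne_top_of_nonneg (by norm_num) hMtop
  have hvb : ∀ k, ∫⁻ z in Q₁, ‖v k z.1 z.2‖ₑ ^ (3 : ℕ) ≤ Mu := fun k => by
    have h := SuitableCompactness.lintegral_enorm_rpow_le_of_eLpNorm_le (q := 3) (by norm_num) ENNReal.ofNat_ne_top
      (hv3 k)
    simp only [ENNReal.toReal_ofNat, ENNReal.rpow_ofNat] at h
    exact h
  have hqb : ∀ k, ∫⁻ z in Q₁, ‖q k z.1 z.2‖ₑ ^ (3 / 2 : ℝ) ≤ Mp := fun k => by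
    have h := SuitableCompactness.lintegral_enorm_rpow_le_of_eLpNorm_le (q := 3 / 2) (by norm_num)
      (ENNReal.div_ne_top (by norm_num) (by norm_num)) (hq32 k)
    rw [toReal_three_halves_eq] at h
    exact h
  -- ## Step 1: uniform local energy bounds on the balls `Q(ρ n)`, `ρ n = 1 - 1/(n+2)`
  set ρ : ℕ → ℝ := fun n => 1 - 1 / ((n : ℝ) + 2) with hρ
  have hρ0 : ∀ n, 0 < ρ n := SuitableCompactness.radius_pos
  have hρ1 : ∀ n, ρ n < 1 := SuitableCompactness.radius_lt_one
  have hρm : Monotone ρ := SuitableCompactness.monotone_radius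
  have hS1 : ∀ n, parabolicCylinder (ρ n) (0 : ℝ × (EuclideanSpace ℝ (Fin 3))) ⊆ Q₁ := fun n =>
    SuitableCompactness.parabolicCylinder_zero_mono (hρ0 n).le (hρ1 n).le
  choose Gv hGv _hGvb using fun k => (hsw k).2.2.1
  have hbounds : ∀ n, ∃ C : ℝ≥0, ∀ k,
      (∀ᵐ t ∂(volume.restrict (Ioo (-(ρ n) ^ 2) 0)),
        ∫⁻ x in ball (0 : (EuclideanSpace ℝ (Fin 3))) (ρ n), ‖v k t x‖ₑ ^ 2 ≤ C) ∧
      ∫⁻ z in parabolicCylinder (ρ n) (0 : ℝ × (EuclideanSpace ℝ (Fin 3))),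
        ENNReal.ofReal (frobeniusNormSq (Gv k z.1 z.2)) ≤ C := by
    intro n
    obtain ⟨C, hC⟩ := SuitableCompactness.exists_uniform_energy_bounds (hρ0 n) (hρ1 n) hMut hMpt
    exact ⟨C, fun k => hC (v k) (q k) (Gv k) (hsw k).1 (hGv k) (hvb k) (hqb k)⟩
  choose C hC using hbounds
  -- ## Step 2: weak `L^{3/2}` compactness of the pressures on `Q`
  haveI : IsFiniteMeasure (volume.restrict Q₁) :=
    SuitableCompactness.isFiniteMeasure_restrict_parabolicCylinder_zero 1
  have hqm : ∀ k, AEStronglyMeasurable (uncurry (q k)) (volume.restrict Q₁) := fun k =>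
    (hsw k).1.distributional.2.2.1.aestronglyMeasurable
  have hpq : (3 / 2 : ℝ).HolderConjugate 3 :=
    Real.holderConjugate_iff.2 ⟨by norm_num, by norm_num⟩
  obtain ⟨σ₀, hσ₀, g, hgmem, hgb, hgw⟩ :=
    FunctionSpaces.exists_subseq_tendsto_integral_mul_of_lintegral_rpow_le'
      (μ := volume.restrict Q₁) hpq (f := fun j => uncurry (q j)) hqm hMpt hqb
  set p : ℝ → (EuclideanSpace ℝ (Fin 3)) → ℝ := fun t x => g (t, x) with hp
  have hpg : uncurry p = g := by funext z; rfl
  have e3 : ENNReal.ofReal 3 = 3 := ENNReal.ofReal_ofNat 3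
  have hπw : ∀ g' : ℝ × (EuclideanSpace ℝ (Fin 3)) → ℝ, MemLp g' 3 (volume.restrict Q₁) →
      Tendsto (fun j => ∫ z in Q₁, q (σ₀ j) z.1 z.2 * g' z) atTop
        (𝓝 (∫ z in Q₁, p z.1 z.2 * g' z)) := fun g' hg' => hgw g' (by rwa [e3])
  -- ## Step 3: the velocities along `σ₀`
  obtain ⟨φ, u, hφ, hu⟩ := SuitableCompactness.velocity_extraction
    (ρ := ρ) hρ0 (fun n => (hρ1 n).le) hρm
    (V := fun k => v (σ₀ k)) (P := fun k => q (σ₀ k)) (GV := fun k => Gv (σ₀ k))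
    (fun k => (hsw _).1.distributional) (fun k => hGv _) (C := C) hMpt
    (fun n k => (hC n (σ₀ k)).1) (fun n k => (hC n (σ₀ k)).2)
    (fun n k => (lintegral_mono_set (hS1 n)).trans (hqb _))
  -- ## Step 4: suitability of the limit on each `Q(ρ n)`
  have hball : ∀ n, IsSuitableWeakSolutionInBall (ρ n) 0 u p ∧
      MemLp (uncurry u) 3
        (volume.restrict (parabolicCylinder (ρ n) (0 : ℝ × (EuclideanSpace ℝ (Fin 3))))) ∧
      Tendsto (fun k => eLpNorm (uncurry (v (σ₀ (φ k))) - uncurry u) 3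
        (volume.restrict (parabolicCylinder (ρ n) (0 : ℝ × (EuclideanSpace ℝ (Fin 3))))))
        atTop (𝓝 0) := by
    intro n
    obtain ⟨hum, huE, hut⟩ := hu n
    have hpmS : AEStronglyMeasurable (uncurry p)
        (volume.restrict (parabolicCylinder (ρ n) (0 : ℝ × (EuclideanSpace ℝ (Fin 3))))) := by
      rw [hpg]
      exact hgmem.1.mono_measure (Measure.restrict_mono (hS1 n) le_rfl)
    have hpbS : ∫⁻ z in parabolicCylinder (ρ n) (0 : ℝ × (EuclideanSpace ℝ (Fin 3))),
        ‖p z.1 z.2‖ₑ ^ (3 / 2 : ℝ) ≤ Mp := (lintegral_mono_set (hS1 n)).trans hgb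
    have hπwS : ∀ g' : ℝ × (EuclideanSpace ℝ (Fin 3)) → ℝ, MemLp g' 3
        (volume.restrict (parabolicCylinder (ρ n) (0 : ℝ × (EuclideanSpace ℝ (Fin 3))))) →
        Tendsto (fun j => ∫ z in parabolicCylinder (ρ n) (0 : ℝ × (EuclideanSpace ℝ (Fin 3))),
          q (σ₀ (φ j)) z.1 z.2 * g' z) atTop
          (𝓝 (∫ z in parabolicCylinder (ρ n) (0 : ℝ × (EuclideanSpace ℝ (Fin 3))),
            p z.1 z.2 * g' z)) := fun g' hg' =>
      (SuitableCompactness.tendsto_setIntegral_mul_of_subset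
        (isOpen_parabolicCylinder _ _).measurableSet (hS1 n) (f := fun j z => q (σ₀ j) z.1 z.2)
        (g := fun z => p z.1 z.2) hπw g' hg').comp hφ.tendsto_atTop
    exact SuitableCompactness.limit_isSuitableWeakSolutionInBall (hρ0 n) (hρ1 n).le hMpt
      (V := fun k => v (σ₀ (φ k))) (P := fun k => q (σ₀ (φ k))) (GV := fun k => Gv (σ₀ (φ k)))
      (fun k => (hsw _).1) (fun k => hGv _) (fun k => (hC n _).1) (fun k => (hC n _).2)
      (fun k => (lintegral_mono_set (hS1 n)).trans (hqb _)) hum huE hut hpmS hpbS hπwS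
  -- ## Step 5: every `R < 1` lies below some `ρ n`
  refine ⟨u, p, fun k => σ₀ (φ k), hσ₀.comp hφ, fun R hR => ?_⟩
  obtain ⟨n, hn⟩ : ∃ n, R ≤ ρ n := SuitableCompactness.exists_le_radius hR.2
  obtain ⟨hIn, hu3, hL3⟩ := hball n
  have hsub : parabolicCylinder R (0 : ℝ × (EuclideanSpace ℝ (Fin 3))) ⊆
      parabolicCylinder (ρ n) (0 : ℝ × (EuclideanSpace ℝ (Fin 3))) :=
    SuitableCompactness.parabolicCylinder_zero_mono hR.1.le hn
  refine ⟨SuitableCompactness.isSuitableWeakSolutionInBall_of_le_radius hIn hR.1 hn,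
    hu3.mono_measure (Measure.restrict_mono hsub le_rfl), ?_, fun g' hg' => ?_⟩
  · exact tendsto_of_tendsto_of_tendsto_of_le_of_le tendsto_const_nhds hL3 (fun _ => zero_le)
      fun k => eLpNorm_mono_measure _ (Measure.restrict_mono hsub le_rfl)
  · exact (SuitableCompactness.tendsto_setIntegral_mul_of_subset
      (isOpen_parabolicCylinder _ _).measurableSet (hsub.trans (hS1 n))
      (f := fun j z => q (σ₀ j) z.1 z.2) (g := fun z => p z.1 z.2) hπw g' hg').comp hφ.tendsto_atTop

end Literature.Analysis.FluidPDE
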